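import Literature.Topology.PlanarFoliations.HugWalk
import Literature.Topology.PlanarFoliations.HugTurn
import Literature.Topology.PlanarFoliations.ProngAccumulation
import Literature.Topology.PlanarFoliations.ChainCrossingStar
import HarnessLib

/-!
# The hugged walk: every state is good

Topic: Topology / PlanarFoliations, sequel to `HugWalk.lean` (the states, junctions and links of
the hugged walk), `HugTurn.lean` (the neighbour of an in-prong is an out-prong), `ProngAccumulation.lean`
(prongs swept by the chain are frontier prongs), `ChainCrossingStar.lean` (the chain crosses the
star vertical at a frontier prong point on one side) and `WalkFencePrefix.lean` (walk fences over
prefixes). **The inductive step of the hugging argument** (Camacho–Lins Neto, Ch. VII §2): the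
compact leaves `K n` of the chain cross the incoming star vertical of the first junction on a side
`s` at levels tending to the base level (`HugData.exists_cross`); if the states below `k` are good,
the walk fence over the prefix of length `k` tracks the leaf `K n` from that vertical to the
incoming vertical of the junction `k` (`WalkFenceData.track`), so the chain crosses there too, on
the same side (`HugData.cross_seq`); crossing the incoming vertical at a height `h` of sign `s`,
the leaf `K n` contains the horizontal of the neighbouring sector `jout = nb jin h`
(`ProngStar.horiz_nb_mem_leaf`), so the outgoing prong is a frontier prong
(`ProngStar.pt_mem_frontier_Dlim_of_horiz`), its leaf is a frontier separatrix leaving the saddle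
along the whole prong arc (`ProngStar.alphaSet_and_bwdTail_nb_of_fwdTail`): the state `k` is good
(`HugData.good_seq`). Hence **all states of the hugged walk are good** (`HugData.forall_good`), all
links are leaf arcs, and the chain crosses every incoming vertical on the side `s`.

## References

* C. Camacho, A. Lins Neto, *Geometric Theory of Foliations*, Birkhäuser (1985), Ch. VII §2
  [CamachoLinsNeto1985].
-/

noncomputable section

open Set Filter Function Metric unitInterval
open _root_.Topology
open Literature.Topology.FourManifolds Literature.Topology.FourManifolds.Foliation

namespace Literature.Topology.PlanarFoliations

namespace StarData

variable {X : Type*} [TopologicalSpace X] [T2Space X] [SecondCountableTopology X] [Nonempty X] {F : Foliation ℝ X} {ι : X → ℂ}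
variable {B : Type*} [NormedAddCommGroup B] [NormedSpace ℝ B] {M : Type*} [TopologicalSpace M] {T : Foliation B M} {g : ℂ → M}
variable {D : StarData F ι T g} {hbi : IsBiOriented F} {hι : IsOpenEmbedding ι} {K : ℕ → X} {H : D.HugHyp hbi hι K}

namespace HugData

/-- **The chain crosses the incoming star vertical of the state on the side `s`**: for every
`ε > 0`, eventually every `K n` passes through a point of the vertical over `pt jin (β, h)` with
`0 < s h`, `|h| < ε`. [folklore] -/
structure Cross (d : HugData H) (s : ℝ) : Prop where
  /-- the crossings -/
  out : ∀ ε > 0, ∃ N, ∀ n ≥ N, ∃ h, 0 < s * h ∧ |h| < ε ∧ d.P.horiz hι d.jin h d.β ∈ F.leaf (K n)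

omit [NormedSpace ℝ B] in
/-- **The chain crosses the incoming vertical of any state on some side.** [folklore] -/
theorem exists_cross (d : HugData H) : ∃ s : ℝ, (s = 1 ∨ s = -1) ∧ d.Cross s := by
  obtain ⟨s, hs, h⟩ := ProngStar.exists_leaf_crossing_star d.P hbi hι H.hK H.hdec d.β_mem_Ioo d.Kin.r_pos d.Kin.ball_subset
    d.pt_mem_frontier
  exact ⟨s, hs, ⟨h⟩⟩

variable (ho : F.IsTransverselyOriented) {s : ℝ} (d₀ : HugData H)

omit [NormedSpace ℝ B] in
/-- The star vertical of the incoming box is the horizontal path read vertically. [folklore] -/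
theorem Kin_T₁ (d : HugData H) (χ : ℝ ≃o ℝ) (τ : ℝ) : d.Kin.T₁ χ τ = d.P.horiz hι d.jin (χ τ) d.β := rfl

include ho in
/-- **The chain crosses the incoming vertical of every state of the hugged walk on the side `s`**,
if it does so at the first state and the earlier states are good (tracking by the prefix walk
fence). [folklore] -/
theorem cross_seq (hs : s = 1 ∨ s = -1) (hcross : d₀.Cross s) (k : ℕ) (hgood : ∀ i < k, ((seq s d₀ i).outDart s).Good hι hbi K) :
    (seq s d₀ k).Cross s := by
  have hℓ : ∀ i < k, Continuous (toLeafSpace ∘ hugLink s hs d₀ i : I → F.LeafSpace) := fun i hi ↦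
    continuous_toLeafSpace_hugLink s hs d₀ (hgood i hi)
  set W := D.walkFencePrefix ho hs (J := hugJ s d₀) (ℓ := hugLink s hs d₀) k hℓ (fun i _ ↦ hugJ_turn s d₀ i) with hW
  refine ⟨fun ε' hε' ↦ ?_⟩
  -- levels close to the base level have small end heights
  have hχc : ContinuousAt W.χ (hugJ s d₀ 0).τ₀ := W.χ.continuous.continuousAt
  have h₁ : ∀ᶠ τ in 𝓝 (hugJ s d₀ 0).τ₀, |W.χ τ| < ε' := by
    have hI : Ioo (-ε') ε' ∈ 𝓝 (W.χ (hugJ s d₀ 0).τ₀) := by rw [W.χ_apply]; exact Ioo_mem_nhds (by linarith) hε'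
    exact Filter.Eventually.mono (hχc.preimage_mem_nhds hI) fun τ hτ ↦ abs_lt.2 hτ
  have h₂ : ∀ᶠ τ in 𝓝 (hugJ s d₀ 0).τ₀, τ ∈ Ioo ((hugJ s d₀ 0).τ₀ - W.ε) ((hugJ s d₀ 0).τ₀ + W.ε) :=
    Ioo_mem_nhds (by linarith [W.ε_pos]) (by linarith [W.ε_pos])
  obtain ⟨η, hη, hηsub⟩ := Metric.eventually_nhds_iff.1 (h₁.and h₂)
  -- heights close to `0` have levels close to the base level
  have hsymm0 : (hugJ s d₀ 0).χ₀.symm 0 = (hugJ s d₀ 0).τ₀ := by rw [← (hugJ s d₀ 0).χ₀_τ₀, OrderIso.symm_apply_apply]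
  have h₃ : ∀ᶠ h in 𝓝 (0 : ℝ), dist ((hugJ s d₀ 0).χ₀.symm h) (hugJ s d₀ 0).τ₀ < η := by
    have hc : ContinuousAt (hugJ s d₀ 0).χ₀.symm 0 := (hugJ s d₀ 0).χ₀.symm.continuous.continuousAt
    have := hc.preimage_mem_nhds (ball_mem_nhds ((hugJ s d₀ 0).χ₀.symm 0) hη)
    rw [hsymm0] at this
    exact this
  obtain ⟨ε₀, hε₀, hε₀sub⟩ := Metric.eventually_nhds_iff.1 h₃
  obtain ⟨N, hN⟩ := hcross.out ε₀ hε₀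
  refine ⟨N, fun n hn ↦ ?_⟩
  obtain ⟨h, hsh, hhε, hmem⟩ := hN n hn
  set τ := (hugJ s d₀ 0).χ₀.symm h with hτdef
  have hχτ : (hugJ s d₀ 0).χ₀ τ = h := (hugJ s d₀ 0).χ₀.apply_symm_apply h
  have hτclose : dist τ (hugJ s d₀ 0).τ₀ < η := hε₀sub (by rw [dist_zero_right]; exact hhε)
  obtain ⟨hτ₁, hτ₂⟩ := hηsub hτclose
  -- the level `τ` is on the side `s`
  have hsτ : 0 < s * (τ - (hugJ s d₀ 0).τ₀) := by
    rcases hs with rfl | rfl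
    · have hh : 0 < h := by linarith
      have : (hugJ 1 d₀ 0).χ₀.symm 0 < (hugJ 1 d₀ 0).χ₀.symm h := (hugJ 1 d₀ 0).χ₀.symm.strictMono hh
      rw [hsymm0] at this; linarith
    · have hh : h < 0 := by linarith
      have : (hugJ (-1) d₀ 0).χ₀.symm h < (hugJ (-1) d₀ 0).χ₀.symm 0 := (hugJ (-1) d₀ 0).χ₀.symm.strictMono hh
      rw [hsymm0] at this; linarith
  -- track the leaf `K n` from the first vertical to the vertical of the junction `k`
  obtain ⟨-, hcont, hΨ0, hΨ1, -, -⟩ := W.track τ hτ₂ hsτ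
  have hstart : W.Ψ 0 τ ∈ F.leaf (K n) := by
    rw [hΨ0]
    show d₀.Kin.T₁ (hugJ s d₀ 0).χ₀ τ ∈ F.leaf (K n)
    rw [d₀.Kin_T₁, hχτ]
    exact hmem
  have hend : W.Ψ 1 τ ∈ F.leaf (K n) := by
    have := F.mem_leaf_of_continuous_toLeafSpace hcont 0 1
    rw [leaf_eq_of_mem hstart] at this
    exact this
  rw [hΨ1] at hend
  refine ⟨W.χ τ, (orderIso_sign W.χ W.χ_apply hs hsτ).1, hτ₁, ?_⟩
  exact hend

omit [NormedSpace ℝ B] in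
/-- **A state crossed on the side `s` is good**: the outgoing prong is a frontier prong, its leaf
a frontier separatrix leaving the saddle along the whole prong arc. [folklore] -/
theorem good_of_cross (hs : s = 1 ∨ s = -1) (d : HugData H) (hcross : d.Cross s) : (d.outDart s).Good hι hbi K := by
  have hρ := d.P.ρ_pos
  have hrect : ∀ {h}, |h| < d.P.ρ → ((d.β, h) : ℝ × ℝ) ∈ d.P.rect := fun hh ↦
    (d.P.mem_rect_iff).2 ⟨d.hβ, ⟨(abs_lt.1 hh).1.le, (abs_lt.1 hh).2.le⟩⟩
  have hne : ∀ {h : ℝ}, ((d.β, h) : ℝ × ℝ) ≠ 0 := fun h0 ↦ d.β_pos.ne' (congrArg Prod.fst h0)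
  -- the horizontal of the out-sector at a crossing height lies in the crossing leaf
  have key : ∀ {n h}, 0 < s * h → |h| < d.P.ρ → d.P.horiz hι d.jin h d.β ∈ F.leaf (K n) →
      ∀ b ∈ Icc 0 d.P.ρ, d.P.horiz hι (d.jout s) h b ∈ F.leaf (K n) := by
    intro n h hsh hhρ hmem b hb
    set x := d.P.horiz hι d.jin h d.β with hx
    have hιx : ι x = d.P.pt d.jin (d.β, h) := d.P.ι_horiz hι (hrect hhρ) hne
    have hxS : ι x ∈ d.P.S d.jin := by rw [hιx]; exact d.P.pt_mem (hrect hhρ)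
    have hHx : d.P.H (ι x) = h := by rw [hιx, d.P.H_pt (hrect hhρ)]
    have hH0 : d.P.H (ι x) ≠ 0 := by rw [hHx]; exact fun h0 ↦ by rw [h0, mul_zero] at hsh; exact lt_irrefl _ hsh
    have h1 := d.P.horiz_nb_mem_leaf hι hxS hH0 hb
    rw [hHx, show d.P.nb d.jin h = d.jout s from (d.junction s).nb_eq_turn hs hsh] at h1
    rw [← leaf_eq_of_mem hmem]
    exact h1
  -- the outgoing prong is a frontier prong
  have hpass : ∀ N, ∀ δ > (0 : ℝ), ∃ m ≥ N, ∃ h : ℝ, h ≠ 0 ∧ |h| < δ ∧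
      ∀ b ∈ Icc 0 d.P.ρ, d.P.horiz hι (d.jout s) h b ∈ F.leaf (K m) := by
    intro N δ hδ
    obtain ⟨N', hN'⟩ := hcross.out (min δ d.P.ρ) (lt_min hδ hρ)
    obtain ⟨h, hsh, hhε, hmem⟩ := hN' (max N N') (le_max_right _ _)
    exact ⟨max N N', le_max_left _ _, h, fun h0 ↦ by rw [h0, mul_zero] at hsh; exact lt_irrefl _ hsh,
      hhε.trans_le (min_le_left _ _), key hsh (hhε.trans_le (min_le_right _ _)) hmem⟩
  have hfr : ∀ b ∈ Ioc 0 d.P.ρ, d.P.pt (d.jout s) (b, 0) ∈ frontier (Dlim ι F K) := fun b hb ↦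
    d.P.pt_mem_frontier_Dlim_of_horiz hbi hι H.hK H.hdec hpass hb
  -- the exit point is a frontier point with line leaf
  set y' := (d.outDart s).exitPt hι with hy'def
  have hιy' : ι y' = d.P.pt (d.jout s) (d.P.ρ, 0) := (d.outDart s).ι_exitPt hι
  have hy' : ι y' ∈ frontier (Dlim ι F K) := by rw [hιy']; exact hfr _ ⟨hρ, le_rfl⟩
  haveI : NoncompactSpace (F.Leaf y') := H.nc hy'
  -- one crossing height, and the turning lemma
  obtain ⟨N, hN⟩ := hcross.out d.P.ρ hρ
  obtain ⟨h, hsh, hhρ, -⟩ := hN N le_rfl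
  have hh0 : h ≠ 0 := fun h0 ↦ by rw [h0, mul_zero] at hsh; exact lt_irrefl _ hsh
  have hnb : d.P.nb d.E.j h = d.jout s := (d.junction s).nb_eq_turn hs hsh
  have hyl : ∀ b ∈ Ioc 0 d.P.ρ, d.P.horiz hι (d.P.nb d.E.j h) 0 b ∈ F.leaf y' := fun b hb ↦ by
    rw [hnb]; exact (d.outDart s).horiz_mem_leaf_exitPt hι hb
  obtain ⟨hα, Eb, hEbj, hEbβ⟩ := d.P.alphaSet_and_bwdTail_nb_of_fwdTail hbi hι d.E d.v_mem_omegaSet hh0 hyl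
  have hαeq : alphaSet hbi ι y' = {d.v} := by
    rw [H.alphaSet_eq hy'] at hα ⊢
    rw [mem_singleton_iff.1 hα]
  exact ⟨‹_›, hy', hαeq, Eb, hEbj.trans hnb, hEbβ⟩

include ho in
/-- **Every state of the hugged walk is good, and crossed on the side `s`**, if the first state is
crossed on the side `s`. [cite: CamachoLinsNeto1985, Ch. VII §2] -/
theorem good_and_cross_seq (hs : s = 1 ∨ s = -1) (hcross : d₀.Cross s) (k : ℕ) :
    ((seq s d₀ k).outDart s).Good hι hbi K ∧ (seq s d₀ k).Cross s := by
  induction k using Nat.strong_induction_on with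
  | _ k ih =>
    have hc := cross_seq ho d₀ hs hcross k fun i hi ↦ (ih i hi).1
    exact ⟨good_of_cross hs _ hc, hc⟩

include ho in
/-- **Every state of the hugged walk is good.** [folklore] -/
theorem good_seq (hs : s = 1 ∨ s = -1) (hcross : d₀.Cross s) (k : ℕ) : ((seq s d₀ k).outDart s).Good hι hbi K :=
  (good_and_cross_seq ho d₀ hs hcross k).1

include ho in
/-- **Every state of the hugged walk is crossed on the side `s`.** [folklore] -/
theorem cross_seq' (hs : s = 1 ∨ s = -1) (hcross : d₀.Cross s) (k : ℕ) : (seq s d₀ k).Cross s :=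
  (good_and_cross_seq ho d₀ hs hcross k).2

include ho in
/-- The states of the hugged walk follow each other. [folklore] -/
theorem seq_succ_eq_next (hs : s = 1 ∨ s = -1) (hcross : d₀.Cross s) (k : ℕ) :
    seq s d₀ (k + 1) = (seq s d₀ k).next s (good_seq ho d₀ hs hcross k) :=
  seq_succ_of_good s d₀ _

include ho in
/-- **All links of the hugged walk are continuous in the leaf topology.** [folklore] -/
theorem continuous_toLeafSpace_hugLink' (hs : s = 1 ∨ s = -1) (hcross : d₀.Cross s) (k : ℕ) :
    Continuous (toLeafSpace ∘ hugLink s hs d₀ k : I → F.LeafSpace) :=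
  continuous_toLeafSpace_hugLink s hs d₀ (good_seq ho d₀ hs hcross k)

end HugData

end StarData

end Literature.Topology.PlanarFoliations
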